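import Mathlib.AlgebraicTopology.SimplexCategory.Basic
import Mathlib.Algebra.Homology.ShortComplex.ModuleCat
import Literature.AlgebraicTopology.SingularHomology.SingularChains
import Literature.AlgebraicTopology.SingularHomology.SingularCochains
import HarnessLib

-- provenance: harness21/H21/H21/Prelude/AlgTop/CupProduct.lean @ 99832fe (interim HEAD d8f2665); M5 mechanical rewrite
/-!
# The cup product on singular cohomology (trunk G04 AlgTop, item C6 `CupProduct`)

The Alexander–Whitney cup product on singular cochains and singular cohomology with coefficients
in a commutative ring `R` (Hatcher, *Algebraic Topology* (2002), §3.2):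
for cochains `φ ∈ Cᵖ(X; R)`, `ψ ∈ Cᵠ(X; R)` and a singular `(p+q)`-simplex `σ`,
`(φ ⌣ ψ)(σ) = φ(σ|[v₀,…,vₚ]) · ψ(σ|[vₚ,…,vₚ₊q])`.

Front and back faces of singular simplices are obtained from Mathlib's inert morphisms
`SimplexCategory.subinterval j l : ⦋l⦌ ⟶ ⦋n⦌` (`i ↦ i + j`): the front `p`-face is
`subinterval 0 p`, the back `q`-face is `subinterval (n - q) q`. Cochains are the honest functions
`SingularSimplex X n → R` of `Literature.Prelude.AlgTop.SingularCochains`. Mathlib has no cup product on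
singular (or simplicial) cochains (searched: `cupProduct`, `cup product`, `AlexanderWhitney`,
`frontFace`); nothing here duplicates Mathlib.

Design: the cochain-level product `cochainCup` is an explicit bilinear map; the Leibniz rule
`d_cochainCup` is proved from the face relations below. The product descends to cocycles
(`singularCochainComplex.cocyclesCup`, using `d_cochainCup`) and then to cohomology classes
(`cupProduct`) through the cokernel presentation `HomologicalComplex.homologyIsCokernel` of
`Hⁿ = Zⁿ / Bⁿ`, twice (once in each variable), exactly as one descends a bilinear map to a
quotient. All data is explicit; the Prop side conditions are the named lemmas
`d_cochainCup` (proved), `cocyclesCup_toCocycles_left`, `cocyclesCup_toCocycles_right`,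
`cupProductCocycles_toCocycles` (all proved from `d_cochainCup`).
Degrees are tracked by explicit equations `h : p + q = n` (no casts on cohomology objects).

The simplicial identities relating faces `dᵢ` to front/back faces (the input of Hatcher's proof
of the Leibniz rule) are `SingularSimplex.frontFace_face_of_lt`, `backFace_face_of_le`,
`frontFace_face_of_le`, `backFace_face_of_ge` (all proved). Two small additions to the cocycle
API of `Literature.Prelude.AlgTop.SingularCochains` live here: `singularCochainComplex.cocyclesMap` and
`singularCohomology.map_π` (`f^*[b] = [f^♯ b]`).

Conventions (see `Literature.Prelude.AlgTop.SingularChains`): `X : Type u` unbundled, `R : Type v` a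
commutative ring, all objects in `ModuleCat.{max u v} R`; here the coefficient module is `R` itself
(the graded-ring case; the module-valued product `Cᵖ(X; R) × Cᵠ(X; M) → Cⁿ(X; M)` is a
straightforward follow-up not needed downstream).

## Main definitions

* `Literature.AlgebraicTopology.SingularHomology.SingularSimplex.frontFace`, `Literature.AlgebraicTopology.SingularHomology.SingularSimplex.backFace`: front/back faces.
* `Literature.cochainCup h : Cᵖ →ₗ[R] Cᵠ →ₗ[R] Cⁿ` (`h : p + q = n`), `Literature.cochainOne : C⁰`.
* `Literature.singularCochainComplex.cocyclesCup h : Zᵖ →ₗ[R] Zᵠ →ₗ[R] Zⁿ`.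
* `Literature.cupProduct h : Hᵖ(X; R) →ₗ[R] Hᵠ(X; R) →ₗ[R] Hⁿ(X; R)` and `Literature.AlgebraicTopology.SingularHomology.singularCohomology.one`.

## Main statements

* `Literature.AlgebraicTopology.SingularHomology.d_cochainCup`: `δ(φ ⌣ ψ) = δφ ⌣ ψ + (-1)ᵖ φ ⌣ δψ` (Hatcher 2002, Lemma 3.6; proved).
* `Literature.AlgebraicTopology.SingularHomology.cupProduct_π_π`: `[a] ⌣ [b] = [a ⌣ b]` (proved).
* `Literature.AlgebraicTopology.SingularHomology.cupProduct_assoc`, `Literature.AlgebraicTopology.SingularHomology.one_cupProduct`, `Literature.AlgebraicTopology.SingularHomology.cupProduct_one` (Hatcher 2002, §3.2, p. 211;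
  proved from the cochain level), `Literature.AlgebraicTopology.SingularHomology.cupProduct_map` (Hatcher 2002, Prop. 3.10; proved),
  `Literature.AlgebraicTopology.SingularHomology.cupProduct_gradedComm` (Hatcher 2002, Thm. 3.11; recorded as a named fact, no proof).

## References

* A. Hatcher, *Algebraic Topology*, CUP 2002, §3.2.
-/

noncomputable section

open CategoryTheory Limits AlgebraicTopology Simplicial Opposite

universe u v

namespace Literature.AlgebraicTopology.SingularHomology

variable (R : Type v) [CommRing R]
variable {X Y Z : Type u} [TopologicalSpace X] [TopologicalSpace Y] [TopologicalSpace Z]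

/-! ### Front and back faces of singular simplices -/

namespace SingularSimplex

variable {p q n : ℕ}

/-- The front `p`-face `σ|[v₀, …, vₚ]` of a singular `n`-simplex `σ`, `p ≤ n` (Hatcher 2002, §3.2,
definition of the cup product): restriction along the inert map
`SimplexCategory.subinterval 0 p : ⦋p⦌ ⟶ ⦋n⦌`, `i ↦ i`. [cite: Hatcher2002, §3.2  definition of the cup product] -/
def frontFace (h : p ≤ n) (σ : SingularSimplex X n) : SingularSimplex X p :=
  (TopCat.toSSet.obj (TopCat.of X)).map (SimplexCategory.subinterval 0 p (by omega)).op σ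

/-- The back `q`-face `σ|[vₙ₋q, …, vₙ]` of a singular `n`-simplex `σ`, `q ≤ n` (Hatcher 2002, §3.2,
definition of the cup product): restriction along the inert map
`SimplexCategory.subinterval (n - q) q : ⦋q⦌ ⟶ ⦋n⦌`, `i ↦ i + (n - q)`. [cite: Hatcher2002, §3.2  definition of the cup product] -/
def backFace (h : q ≤ n) (σ : SingularSimplex X n) : SingularSimplex X q :=
  (TopCat.toSSet.obj (TopCat.of X)).map (SimplexCategory.subinterval (n - q) q (by omega)).op σ

/-- Composition of inert maps: `subinterval j a ≫ subinterval k b = subinterval (j + k) a`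
(an identity in the simplex category; Hatcher 2002, §3.2, iterated faces). [cite: Hatcher2002, §3.2  iterated faces] -/
lemma subinterval_comp_subinterval {a b c : ℕ} (j k l : ℕ) (hj : j + a ≤ b) (hk : k + b ≤ c)
    (hl : l + a ≤ c) (e : j + k = l) :
    SimplexCategory.subinterval j a hj ≫ SimplexCategory.subinterval k b hk =
      SimplexCategory.subinterval l a hl := by
  subst e
  ext i : 3
  simp [SimplexCategory.subinterval]
  omega

/-- The inert map `subinterval j n : ⦋n⦌ ⟶ ⦋n⦌` (necessarily `j = 0`) is the identity
(Hatcher 2002, §3.2). [cite: Hatcher2002, §3.2] -/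
lemma subinterval_eq_id (j : ℕ) (hj : j + n ≤ n) :
    SimplexCategory.subinterval j n hj = 𝟙 ⦋n⦌ := by
  ext i : 3
  simp [SimplexCategory.subinterval, Fin.ext_iff]
  omega

/-- Iterated restriction along inert maps, at the level of singular simplices
(Hatcher 2002, §3.2, iterated faces). [cite: Hatcher2002, §3.2  iterated faces] -/
lemma map_subinterval_map_subinterval {a b c : ℕ} (j k l : ℕ) (hj : j + a ≤ b) (hk : k + b ≤ c)
    (hl : l + a ≤ c) (e : j + k = l) (σ : SingularSimplex X c) :
    (TopCat.toSSet.obj (TopCat.of X)).map (SimplexCategory.subinterval j a hj).op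
      ((TopCat.toSSet.obj (TopCat.of X)).map (SimplexCategory.subinterval k b hk).op σ) =
      (TopCat.toSSet.obj (TopCat.of X)).map (SimplexCategory.subinterval l a hl).op σ := by
  rw [← subinterval_comp_subinterval j k l hj hk hl e, op_comp, Functor.map_comp_apply]

/-- The front `n`-face of an `n`-simplex is the simplex itself (Hatcher 2002, §3.2). [cite: Hatcher2002, §3.2] -/
@[simp]
lemma frontFace_self (h : n ≤ n) (σ : SingularSimplex X n) : σ.frontFace h = σ := by
  simp [frontFace, subinterval_eq_id]

/-- The back `n`-face of an `n`-simplex is the simplex itself (Hatcher 2002, §3.2). [cite: Hatcher2002, §3.2] -/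
@[simp]
lemma backFace_self (h : n ≤ n) (σ : SingularSimplex X n) : σ.backFace h = σ := by
  simp [backFace, subinterval_eq_id]

/-- The front `p`-face of the front `q`-face is the front `p`-face (Hatcher 2002, §3.2). [cite: Hatcher2002, §3.2] -/
@[simp]
lemma frontFace_frontFace (hp : p ≤ q) (hq : q ≤ n) (σ : SingularSimplex X n) :
    (σ.frontFace hq).frontFace hp = σ.frontFace (hp.trans hq) :=
  map_subinterval_map_subinterval _ _ _ _ _ _ rfl σ

/-- The back `p`-face of the back `q`-face is the back `p`-face (Hatcher 2002, §3.2). [cite: Hatcher2002, §3.2] -/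
@[simp]
lemma backFace_backFace (hp : p ≤ q) (hq : q ≤ n) (σ : SingularSimplex X n) :
    (σ.backFace hq).backFace hp = σ.backFace (hp.trans hq) :=
  map_subinterval_map_subinterval _ _ _ _ _ _ (by omega) σ

/-- The "middle face": the back `q`-face of the front `m`-face equals the front `q`-face of the
back `k`-face when `m - q = n - k` (both are `σ|[vₚ, …, vₚ₊q]` with `p = m - q`; used for
associativity of the cup product, Hatcher 2002, §3.2, p. 211). [cite: Hatcher2002, §3.2  p. 211] -/
lemma backFace_frontFace {m k : ℕ} (hq : q ≤ m) (hm : m ≤ n) (hq' : q ≤ k) (hk : k ≤ n)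
    (e : m - q = n - k) (σ : SingularSimplex X n) :
    (σ.frontFace hm).backFace hq = (σ.backFace hk).frontFace hq' := by
  rw [backFace, frontFace, frontFace, backFace,
    map_subinterval_map_subinterval _ _ (m - q) _ _ (by omega) (by omega),
    map_subinterval_map_subinterval _ _ (m - q) _ _ (by omega) (by omega)]

/-- Front faces commute with push-forward along a continuous map (naturality; Hatcher 2002,
§3.2, proof of Prop. 3.10). [cite: Hatcher2002, §3.2  proof of Prop. 3.10] -/
@[simp]
lemma frontFace_map (f : C(X, Y)) (h : p ≤ n) (σ : SingularSimplex X n) :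
    (σ.map f).frontFace h = (σ.frontFace h).map f :=
  (NatTrans.naturality_apply (TopCat.toSSet.map (TopCat.ofHom f)) _ σ).symm

/-- Back faces commute with push-forward along a continuous map (naturality; Hatcher 2002,
§3.2, proof of Prop. 3.10). [cite: Hatcher2002, §3.2  proof of Prop. 3.10] -/
@[simp]
lemma backFace_map (f : C(X, Y)) (h : q ≤ n) (σ : SingularSimplex X n) :
    (σ.map f).backFace h = (σ.backFace h).map f :=
  (NatTrans.naturality_apply (TopCat.toSSet.map (TopCat.ofHom f)) _ σ).symm

/-! #### Faces versus front/back faces (the relations behind the Leibniz rule) -/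

/-- Deleting a vertex beyond `p` does not change the front `p`-face:
`(dᵢσ)|[v₀,…,vₚ] = σ|[v₀,…,vₚ]` for `p < i` (Hatcher 2002, §3.2, proof of Lemma 3.6). [cite: Hatcher2002, §3.2  proof of Lemma 3.6] -/
lemma frontFace_face_of_lt (i : Fin (n + 2)) (h : p ≤ n) (hi : p < (i : ℕ))
    (σ : SingularSimplex X (n + 1)) :
    (σ.face i).frontFace h = σ.frontFace (Nat.le_succ_of_le h) := by
  have e : SimplexCategory.subinterval 0 p (show 0 + p ≤ n by omega) ≫ SimplexCategory.δ i =
      SimplexCategory.subinterval 0 p (by omega) := by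
    ext k : 3
    obtain ⟨k, hk⟩ := k
    change k < p + 1 at hk
    simp [SimplexCategory.subinterval, SimplexCategory.δ, Fin.succAbove, Fin.ext_iff, Fin.lt_def]
    omega
  change (TopCat.toSSet.obj (TopCat.of X)).map _ ((TopCat.toSSet.obj (TopCat.of X)).map _ σ) = _
  rw [← Functor.map_comp_apply, ← op_comp, e]
  rfl

/-- Deleting a vertex before the back `q`-face does not change it:
`(dᵢσ)|[vₙ₊₁₋q,…,vₙ₊₁] = σ|[vₙ₊₁₋q,…,vₙ₊₁]` for `i + q ≤ n` (Hatcher 2002, §3.2, proof of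
Lemma 3.6). [cite: Hatcher2002, §3.2  proof of Lemma 3.6] -/
lemma backFace_face_of_le (i : Fin (n + 2)) (h : q ≤ n) (hi : (i : ℕ) + q ≤ n)
    (σ : SingularSimplex X (n + 1)) :
    (σ.face i).backFace h = σ.backFace (Nat.le_succ_of_le h) := by
  have e : SimplexCategory.subinterval (n - q) q (show n - q + q ≤ n by omega) ≫
      SimplexCategory.δ i = SimplexCategory.subinterval (n + 1 - q) q (by omega) := by
    ext k : 3
    obtain ⟨k, hk⟩ := k
    simp [SimplexCategory.subinterval, SimplexCategory.δ, Fin.succAbove, Fin.ext_iff, Fin.lt_def]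
    split_ifs <;> simp <;> omega
  change (TopCat.toSSet.obj (TopCat.of X)).map _ ((TopCat.toSSet.obj (TopCat.of X)).map _ σ) = _
  rw [← Functor.map_comp_apply, ← op_comp, e]
  rfl

/-- For `i ≤ p + 1`, the front `p`-face of `dᵢσ` is the `i`-th face of the front `(p+1)`-face of
`σ` (Hatcher 2002, §3.2, proof of Lemma 3.6, first sum). [cite: Hatcher2002, §3.2  proof of Lemma 3.6  first sum] -/
lemma frontFace_face_of_le (i : Fin (n + 2)) (h : p + 1 ≤ n + 1) (hi : (i : ℕ) ≤ p + 1)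
    (σ : SingularSimplex X (n + 1)) :
    (σ.face i).frontFace (Nat.le_of_succ_le_succ h) =
      (σ.frontFace h).face ⟨i, by omega⟩ := by
  have e : SimplexCategory.subinterval 0 p (show 0 + p ≤ n by omega) ≫ SimplexCategory.δ i =
      SimplexCategory.δ (⟨i, by omega⟩ : Fin (p + 2)) ≫
        SimplexCategory.subinterval 0 (p + 1) (by omega) := by
    ext k : 3
    obtain ⟨k, hk⟩ := k
    simp [SimplexCategory.subinterval, SimplexCategory.δ, Fin.succAbove, Fin.ext_iff, Fin.lt_def]
    split_ifs <;> simp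
  change (TopCat.toSSet.obj (TopCat.of X)).map _ ((TopCat.toSSet.obj (TopCat.of X)).map _ σ) =
    (TopCat.toSSet.obj (TopCat.of X)).map _ ((TopCat.toSSet.obj (TopCat.of X)).map _ σ)
  rw [← Functor.map_comp_apply, ← op_comp, e, op_comp, Functor.map_comp_apply]

/-- For `n - q ≤ i`, the back `q`-face of `dᵢσ` is the `(i - (n - q))`-th face of the back
`(q+1)`-face of `σ` (Hatcher 2002, §3.2, proof of Lemma 3.6, second sum). [cite: Hatcher2002, §3.2  proof of Lemma 3.6  second sum] -/
lemma backFace_face_of_ge (i : Fin (n + 2)) (h : q + 1 ≤ n + 1) (hi : n - q ≤ (i : ℕ))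
    (σ : SingularSimplex X (n + 1)) :
    (σ.face i).backFace (Nat.le_of_succ_le_succ h) =
      (σ.backFace h).face ⟨i - (n - q), by omega⟩ := by
  have e : SimplexCategory.subinterval (n - q) q (show n - q + q ≤ n by omega) ≫
      SimplexCategory.δ i = SimplexCategory.δ (⟨i - (n - q), by omega⟩ : Fin (q + 2)) ≫
        SimplexCategory.subinterval (n + 1 - (q + 1)) (q + 1) (by omega) := by
    ext k : 3
    obtain ⟨k, hk⟩ := k
    simp [SimplexCategory.subinterval, SimplexCategory.δ, Fin.succAbove, Fin.ext_iff, Fin.lt_def]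
    split_ifs <;> simp <;> omega
  change (TopCat.toSSet.obj (TopCat.of X)).map _ ((TopCat.toSSet.obj (TopCat.of X)).map _ σ) =
    (TopCat.toSSet.obj (TopCat.of X)).map _ ((TopCat.toSSet.obj (TopCat.of X)).map _ σ)
  rw [← Functor.map_comp_apply, ← op_comp, e, op_comp, Functor.map_comp_apply]

/-- The last face of the front `(p+1)`-face is the front `p`-face:
`(σ|[v₀,…,vₚ₊₁])|[v₀,…,vₚ] = σ|[v₀,…,vₚ]` (Hatcher 2002, §3.2, proof of Lemma 3.6, the cancelling
terms). [cite: Hatcher2002, §3.2  proof of Lemma 3.6] -/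
lemma face_frontFace_last (h : p + 1 ≤ n + 1) (hp : p + 1 < p + 2)
    (σ : SingularSimplex X (n + 1)) :
    (σ.frontFace h).face ⟨p + 1, hp⟩ = σ.frontFace (Nat.le_of_succ_le h) := by
  rw [← frontFace_face_of_le ⟨p + 1, by omega⟩ h (show p + 1 ≤ p + 1 from le_rfl) σ,
    frontFace_face_of_lt _ _ (show p < p + 1 by omega)]

/-- The `0`-th face of the back `(q+1)`-face is the back `q`-face:
`(σ|[vₙ₋q₋₁,…,vₙ])|[vₙ₋q,…,vₙ] = σ|[vₙ₋q,…,vₙ]` (Hatcher 2002, §3.2, proof of Lemma 3.6, the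
cancelling terms). [cite: Hatcher2002, §3.2  proof of Lemma 3.6] -/
lemma face_backFace_zero (h : q + 1 ≤ n + 1) (hq : 0 < q + 2)
    (σ : SingularSimplex X (n + 1)) :
    (σ.backFace h).face ⟨0, hq⟩ = σ.backFace (Nat.le_of_succ_le h) := by
  have e : (⟨0, hq⟩ : Fin (q + 2)) = ⟨(n - q) - (n - q), by omega⟩ := Fin.ext (by simp)
  rw [e, ← backFace_face_of_ge ⟨n - q, by omega⟩ h (show n - q ≤ n - q from le_rfl) σ,
    backFace_face_of_le _ _ (show n - q + q ≤ n by omega)]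

/-- For `p + q = n`, the back `q`-face of `d_{p+1+j} σ` is the `(j+1)`-st face of the back
`(q+1)`-face of `σ` (Hatcher 2002, §3.2, proof of Lemma 3.6, second sum, reindexed). [cite: Hatcher2002, §3.2  proof of Lemma 3.6  second sum] -/
lemma backFace_face_add (j : ℕ) (hj : p + 1 + j < p + q + 2) (h : q ≤ p + q)
    (σ : SingularSimplex X (p + q + 1)) :
    (σ.face ⟨p + 1 + j, hj⟩).backFace h =
      (σ.backFace (by omega : q + 1 ≤ p + q + 1)).face ⟨j + 1, by omega⟩ := by
  rw [backFace_face_of_ge ⟨p + 1 + j, hj⟩ (by omega) (show p + q - q ≤ p + 1 + j by omega) σ]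
  congr 1
  exact Fin.ext (show p + 1 + j - (p + q - q) = j + 1 by omega)

end SingularSimplex

/-! ### The cup product on cochains -/

section Cochain

variable {R} {p q n : ℕ}

/-- The Alexander–Whitney cup product of singular cochains,
`(φ ⌣ ψ)(σ) = φ(σ|[v₀,…,vₚ]) · ψ(σ|[vₚ,…,vₙ])` for `φ ∈ Cᵖ(X; R)`, `ψ ∈ Cᵠ(X; R)`, `p + q = n`
(Hatcher 2002, §3.2, p. 206), as an `R`-bilinear map. [cite: Hatcher2002, §3.2  p. 206] -/
def cochainCup (h : p + q = n) :
    (SingularSimplex X p → R) →ₗ[R] (SingularSimplex X q → R) →ₗ[R] (SingularSimplex X n → R) :=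
  LinearMap.mk₂ R
    (fun φ ψ σ ↦ φ (σ.frontFace (by omega)) * ψ (σ.backFace (by omega)))
    (fun _ _ _ ↦ funext fun _ ↦ by simp [add_mul])
    (fun _ _ _ ↦ funext fun _ ↦ by simp [mul_assoc])
    (fun _ _ _ ↦ funext fun _ ↦ by simp [mul_add])
    (fun _ _ _ ↦ funext fun _ ↦ by simp [mul_left_comm])

/-- The cup product formula `(φ ⌣ ψ)(σ) = φ(σ|[v₀,…,vₚ]) · ψ(σ|[vₚ,…,vₙ])`
(Hatcher 2002, §3.2, p. 206). [cite: Hatcher2002, §3.2  p. 206] -/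
@[simp]
lemma cochainCup_apply (h : p + q = n) (φ : SingularSimplex X p → R)
    (ψ : SingularSimplex X q → R) (σ : SingularSimplex X n) :
    cochainCup h φ ψ σ = φ (σ.frontFace (by omega)) * ψ (σ.backFace (by omega)) :=
  rfl

variable (R X) in
/-- The unit cochain `1 ∈ C⁰(X; R)`, taking the value `1` on every `0`-simplex
(Hatcher 2002, §3.2, p. 211, "the identity for cup product"). [cite: Hatcher2002, §3.2  p. 211  "the identity for cup prod] -/
def cochainOne : SingularSimplex X 0 → R := 1

/-- `1(σ) = 1` (Hatcher 2002, §3.2, p. 211). [cite: Hatcher2002, §3.2  p. 211] -/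
@[simp]
lemma cochainOne_apply (σ : SingularSimplex X 0) : cochainOne R X σ = 1 := rfl

/-- `φ ⌣ 1 = φ` on cochains (Hatcher 2002, §3.2, p. 211). [cite: Hatcher2002, §3.2  p. 211] -/
@[simp]
lemma cochainCup_one (φ : SingularSimplex X p → R) :
    cochainCup (Nat.add_zero p) φ (cochainOne R X) = φ := by
  ext σ
  simp

/-- `1 ⌣ ψ = ψ` on cochains (Hatcher 2002, §3.2, p. 211). [cite: Hatcher2002, §3.2  p. 211] -/
@[simp]
lemma one_cochainCup (ψ : SingularSimplex X q → R) :
    cochainCup (Nat.zero_add q) (cochainOne R X) ψ = ψ := by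
  ext σ
  simp

/-- Associativity of the cup product on cochains, `(φ ⌣ ψ) ⌣ χ = φ ⌣ (ψ ⌣ χ)`
(Hatcher 2002, §3.2, p. 211: "associative … on the level of cochains"). The four degree
equations relate `φ ∈ Cᵖ`, `ψ ∈ Cᵠ`, `χ ∈ Cʳ`, `p + q = m`, `q + r = k`, `m + r = p + k = s`. [cite: Hatcher2002, §3.2  p. 211: "associative … on the leve] -/
lemma cochainCup_assoc {r m k s : ℕ} (hpq : p + q = m) (hqr : q + r = k) (hm : m + r = s)
    (hk : p + k = s) (φ : SingularSimplex X p → R) (ψ : SingularSimplex X q → R)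
    (χ : SingularSimplex X r → R) :
    cochainCup hm (cochainCup hpq φ ψ) χ = cochainCup hk φ (cochainCup hqr ψ χ) := by
  ext σ
  simp only [cochainCup_apply, SingularSimplex.frontFace_frontFace,
    SingularSimplex.backFace_backFace, mul_assoc]
  rw [SingularSimplex.backFace_frontFace (k := k) _ _ (by omega) (by omega) (by omega)]

/-- Naturality of the cochain cup product: `f^♯(φ ⌣ ψ) = f^♯φ ⌣ f^♯ψ`
(Hatcher 2002, §3.2, proof of Prop. 3.10). [cite: Hatcher2002, §3.2  proof of Prop. 3.10] -/
lemma cochainCup_map (f : C(X, Y)) (h : p + q = n) (φ : SingularSimplex Y p → R)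
    (ψ : SingularSimplex Y q → R) :
    (singularCochainComplex.map R R f).f n (cochainCup h φ ψ) =
      cochainCup h ((singularCochainComplex.map R R f).f p φ)
        ((singularCochainComplex.map R R f).f q ψ) := by
  ext σ
  simp

/-- The Leibniz rule `δ(φ ⌣ ψ) = δφ ⌣ ψ + (-1)ᵖ φ ⌣ δψ` for `φ ∈ Cᵖ(X; R)`, `ψ ∈ Cᵠ(X; R)`
(Hatcher 2002, Lemma 3.6). [cite: Hatcher2002, Lemma 3.6] -/
theorem d_cochainCup (h : p + q = n) (φ : SingularSimplex X p → R)
    (ψ : SingularSimplex X q → R) :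
    (singularCochainComplex R R X).d n (n + 1) (cochainCup h φ ψ) =
      cochainCup (show (p + 1) + q = n + 1 by omega)
          ((singularCochainComplex R R X).d p (p + 1) φ) ψ +
        (-1 : R) ^ p • cochainCup (show p + (q + 1) = n + 1 by omega) φ
          ((singularCochainComplex R R X).d q (q + 1) ψ) := by
  subst h
  refine singularCochainComplex.ext fun σ ↦ ?_
  change _ = cochainCup _ _ _ σ + (-1 : R) ^ p * cochainCup _ _ _ σ
  simp only [singularCochainComplex.d_apply, cochainCup_apply, smul_eq_mul, Finset.sum_mul,
    Finset.mul_sum]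
  have hsplit : ∀ f : ℕ → R, ∑ i ∈ Finset.range (p + q + 2), f i =
      ∑ i ∈ Finset.range (p + 1), f i + ∑ j ∈ Finset.range (q + 1), f (p + 1 + j) := fun f ↦ by
    rw [← Finset.sum_range_add, show p + 1 + (q + 1) = p + q + 2 by omega]
  rw [Finset.sum_fin_eq_sum_range (n := p + q + 2), Finset.sum_fin_eq_sum_range (n := p + 2),
    Finset.sum_fin_eq_sum_range (n := q + 2), Finset.sum_range_succ (n := p + 1),
    Finset.sum_range_succ' (n := q + 1), hsplit]
  symm
  rw [add_add_add_comm]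
  refine Eq.trans ?_ (add_zero _)
  congr 1
  · congr 1
    · -- terms `i ≤ p`: `dᵢ` acts on the front `(p+1)`-face and fixes the back `q`-face
      refine Finset.sum_congr rfl fun i hi ↦ ?_
      rw [Finset.mem_range] at hi
      rw [dif_pos (show i < p + 2 by omega), dif_pos (show i < p + q + 2 by omega),
        SingularSimplex.frontFace_face_of_le (p := p) ⟨i, by omega⟩ (by omega)
          (show i ≤ p + 1 by omega) σ,
        SingularSimplex.backFace_face_of_le (q := q) ⟨i, by omega⟩ (by omega)
          (show i + q ≤ p + q by omega) σ]
      ring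
    · -- terms `i = p + 1 + j`: `dᵢ` fixes the front `p`-face and acts on the back `(q+1)`-face
      refine Finset.sum_congr rfl fun j hj ↦ ?_
      rw [Finset.mem_range] at hj
      rw [dif_pos (show j + 1 < q + 2 by omega), dif_pos (show p + 1 + j < p + q + 2 by omega),
        SingularSimplex.frontFace_face_of_lt (p := p) ⟨p + 1 + j, by omega⟩ (by omega)
          (show p < p + 1 + j by omega) σ,
        SingularSimplex.backFace_face_add j _ _ σ]
      ring
  · -- the two remaining terms cancel
    rw [dif_pos (show p + 1 < p + 2 by omega), dif_pos (show 0 < q + 2 by omega),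
      SingularSimplex.face_frontFace_last, SingularSimplex.face_backFace_zero]
    ring

end Cochain

/-! ### The cup product on cocycles -/

namespace singularCochainComplex

variable {R} {M : Type v} [AddCommGroup M] [Module R M] {p q n : ℕ}

/-- Cocycles are determined by their underlying cochains (`Zⁿ ↪ Cⁿ` is injective;
Hatcher 2002, §3.1). [cite: Hatcher2002, §3.1] -/
lemma cocycles_ext {a b : cocycles R M X n} (h : iCocycles R M X n a = iCocycles R M X n b) :
    a = b :=
  (ModuleCat.mono_iff_injective (iCocycles R M X n)).1 inferInstance h

/-- The coboundary of (the underlying cochain of) a cocycle vanishes (Hatcher 2002, §3.1). [cite: Hatcher2002, §3.1] -/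
@[simp]
lemma d_iCocycles (j : ℕ) (a : cocycles R M X n) :
    (singularCochainComplex R M X).d n j (iCocycles R M X n a) = 0 := by
  change (iCocycles R M X n ≫ (singularCochainComplex R M X).d n j) a = 0
  rw [HomologicalComplex.iCycles_d]
  rfl

/-- Pointwise form of `d_iCocycles` (Hatcher 2002, §3.1). [cite: Hatcher2002, §3.1] -/
@[simp]
lemma d_iCocycles_apply (j : ℕ) (a : cocycles R M X n) (τ : SingularSimplex X j) :
    (singularCochainComplex R M X).d n j (iCocycles R M X n a) τ = 0 := by
  rw [d_iCocycles]
  rfl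

/-- The underlying cochain of `toCocycles i j φ` is `δφ` (Hatcher 2002, §3.1). [cite: Hatcher2002, §3.1] -/
@[simp]
lemma iCocycles_toCocycles (i j : ℕ) (φ : (singularCochainComplex R M X).X i) :
    iCocycles R M X j (toCocycles R M X i j φ) = (singularCochainComplex R M X).d i j φ := by
  change (toCocycles R M X i j ≫ iCocycles R M X j) φ = _
  rw [HomologicalComplex.toCycles_i]

/-- Cohomology classes of coboundaries vanish: `π (toCocycles i j φ) = 0` (Hatcher 2002, §3.1). [cite: Hatcher2002, §3.1] -/
@[simp]
lemma π_toCocycles (i j : ℕ) (φ : (singularCochainComplex R M X).X i) :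
    singularCohomology.π R M X j (toCocycles R M X i j φ) = 0 := by
  change (toCocycles R M X i j ≫ (singularCochainComplex R M X).homologyπ j) φ = 0
  rw [HomologicalComplex.toCycles_comp_homologyπ]
  rfl

variable (R M) in
/-- The map `f^♯ : Zⁿ(Y; M) ⟶ Zⁿ(X; M)` induced on cocycles by a continuous map `f : X → Y`
(Hatcher 2002, §3.1); `HomologicalComplex.cyclesMap` of `singularCochainComplex.map f`. [cite: Hatcher2002, §3.1] -/
abbrev cocyclesMap (f : C(X, Y)) (n : ℕ) : cocycles R M Y n ⟶ cocycles R M X n :=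
  HomologicalComplex.cyclesMap (singularCochainComplex.map R M f) n

/-- The underlying cochain of `f^♯ b` is `f^♯` of the underlying cochain of `b`
(Hatcher 2002, §3.1); from `HomologicalComplex.cyclesMap_i`. [cite: Hatcher2002, §3.1] -/
@[simp]
lemma iCocycles_cocyclesMap (f : C(X, Y)) (b : cocycles R M Y n) :
    iCocycles R M X n (cocyclesMap R M f n b) = (map R M f).f n (iCocycles R M Y n b) := by
  change (cocyclesMap R M f n ≫ iCocycles R M X n) b = (iCocycles R M Y n ≫ (map R M f).f n) b
  rw [HomologicalComplex.cyclesMap_i]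

/-- Induced maps on cohomology are computed on representing cocycles: `f^*[b] = [f^♯ b]`
(Hatcher 2002, §3.1); from `HomologicalComplex.homologyπ_naturality`. [cite: Hatcher2002, §3.1] -/
lemma _root_.Literature.AlgebraicTopology.SingularHomology.singularCohomology.map_π (f : C(X, Y)) (b : cocycles R M Y n) :
    singularCohomology.map R M f n (singularCohomology.π R M Y n b) =
      singularCohomology.π R M X n (cocyclesMap R M f n b) := by
  change ((singularCochainComplex R M Y).homologyπ n ≫
    HomologicalComplex.homologyMap (map R M f) n) b =
    (cocyclesMap R M f n ≫ (singularCochainComplex R M X).homologyπ n) b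
  rw [HomologicalComplex.homologyπ_naturality]

/-- The cup product of two cocycles is a cocycle (from the Leibniz rule; Hatcher 2002, §3.2,
p. 206). [cite: Hatcher2002, §3.2  p. 206] -/
lemma d_cochainCup_iCocycles (h : p + q = n) (a : cocycles R R X p) (b : cocycles R R X q) :
    (singularCochainComplex R R X).d n (n + 1)
      (cochainCup h (iCocycles R R X p a) (iCocycles R R X q b)) = 0 := by
  rw [d_cochainCup]
  refine singularCochainComplex.ext fun σ ↦ ?_
  change cochainCup _ _ _ σ + (-1 : R) ^ p * cochainCup _ _ _ σ = (0 : R)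
  simp only [cochainCup_apply, d_iCocycles_apply, zero_mul, mul_zero, add_zero]

/-- The cup product on cocycles `Zᵖ(X; R) × Zᵠ(X; R) → Zⁿ(X; R)`, `p + q = n`, as an `R`-bilinear
map (Hatcher 2002, §3.2, p. 206: "the cup product of two cocycles is again a cocycle").
Relies on: `d_cochainCup` (Leibniz rule). [cite: Hatcher2002, §3.2  p. 206: "the cup product of two co] -/
def cocyclesCup (h : p + q = n) : cocycles R R X p →ₗ[R] cocycles R R X q →ₗ[R] cocycles R R X n :=
  LinearMap.mk₂ R
    (fun a b ↦ cocyclesMk (cochainCup h (iCocycles R R X p a) (iCocycles R R X q b))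
      (d_cochainCup_iCocycles h a b))
    (fun _ _ _ ↦ cocycles_ext (by
      simp only [iCocycles_mk, map_add]
      exact LinearMap.map_add₂ (cochainCup h) _ _ _))
    (fun _ _ _ ↦ cocycles_ext (by
      simp only [iCocycles_mk, map_smul]
      exact LinearMap.map_smul₂ (cochainCup h) _ _ _))
    (fun _ _ _ ↦ cocycles_ext (by
      simp only [iCocycles_mk, map_add]
      exact LinearMap.map_add (cochainCup h _) _ _))
    (fun _ _ _ ↦ cocycles_ext (by
      simp only [iCocycles_mk, map_smul]
      exact LinearMap.map_smul (cochainCup h _) _ _))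

/-- The underlying cochain of the cup product of cocycles is the cup product of the underlying
cochains (Hatcher 2002, §3.2). [cite: Hatcher2002, §3.2] -/
@[simp]
lemma iCocycles_cocyclesCup (h : p + q = n) (a : cocycles R R X p) (b : cocycles R R X q) :
    iCocycles R R X n (cocyclesCup h a b) =
      cochainCup h (iCocycles R R X p a) (iCocycles R R X q b) :=
  iCocycles_mk _ (d_cochainCup_iCocycles h a b)

/-- The cup product of a coboundary with a cocycle is a coboundary: `δφ ⌣ b = δ(φ ⌣ b)` for a
cocycle `b` (Hatcher 2002, §3.2, p. 206). Stated for the differential `d i p` with arbitrary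
source index `i` (it is zero unless `i + 1 = p`). [cite: Hatcher2002, §3.2  p. 206] -/
lemma cocyclesCup_toCocycles_left (h : p + q = n) {i m : ℕ} (hm : i + q = m)
    (φ : (singularCochainComplex R R X).X i) (b : cocycles R R X q) :
    cocyclesCup h (toCocycles R R X i p φ) b =
      toCocycles R R X m n (cochainCup hm φ (iCocycles R R X q b)) := by
  refine cocycles_ext ?_
  simp only [iCocycles_cocyclesCup, iCocycles_toCocycles]
  by_cases hi : i + 1 = p
  · subst hi
    obtain rfl : m + 1 = n := by omega
    rw [d_cochainCup hm]
    refine singularCochainComplex.ext fun σ ↦ ?_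
    change cochainCup _ _ _ σ = cochainCup _ _ _ σ + (-1 : R) ^ i * cochainCup _ _ _ σ
    simp only [cochainCup_apply, d_iCocycles_apply, mul_zero, add_zero]
  · rw [(singularCochainComplex R R X).shape i p hi, (singularCochainComplex R R X).shape m n
      (by change m + 1 ≠ n; omega)]
    simp only [ModuleCat.hom_zero, LinearMap.zero_apply]
    exact LinearMap.map_zero₂ (cochainCup h) _

/-- The cup product of a cocycle with a coboundary is a coboundary: `a ⌣ δψ = (-1)ᵖ δ(a ⌣ ψ)`
for a cocycle `a ∈ Zᵖ` (Hatcher 2002, §3.2, p. 206). Stated for the differential `d i q` with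
arbitrary source index `i`. [cite: Hatcher2002, §3.2  p. 206] -/
lemma cocyclesCup_toCocycles_right (h : p + q = n) {i m : ℕ} (hm : p + i = m)
    (a : cocycles R R X p) (ψ : (singularCochainComplex R R X).X i) :
    cocyclesCup h a (toCocycles R R X i q ψ) =
      (-1 : R) ^ p • toCocycles R R X m n (cochainCup hm (iCocycles R R X p a) ψ) := by
  refine cocycles_ext ?_
  simp only [iCocycles_cocyclesCup, iCocycles_toCocycles, map_smul]
  by_cases hi : i + 1 = q
  · subst hi
    obtain rfl : m + 1 = n := by omega
    rw [d_cochainCup hm]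
    refine singularCochainComplex.ext fun σ ↦ ?_
    change cochainCup _ _ _ σ = (-1 : R) ^ p * (cochainCup _ _ _ σ + (-1 : R) ^ p * cochainCup _ _ _ σ)
    simp only [cochainCup_apply, d_iCocycles_apply, zero_mul, zero_add, ← mul_assoc, ← mul_pow,
      neg_one_mul, neg_neg, one_pow, one_mul]
  · rw [(singularCochainComplex R R X).shape i q hi, (singularCochainComplex R R X).shape m n
      (by change m + 1 ≠ n; omega)]
    simp only [ModuleCat.hom_zero, LinearMap.zero_apply, smul_zero]
    exact LinearMap.map_zero (cochainCup h _)

end singularCochainComplex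

/-! ### The cup product on cohomology -/

section CupProduct

variable {R} {p q n : ℕ}

open singularCochainComplex

/-- First descent step: for a cocycle `a ∈ Zᵖ`, the morphism `Hᵠ(X; R) ⟶ Hⁿ(X; R)`,
`[b] ↦ [a ⌣ b]`, obtained from `b ↦ π(a ⌣ b)` by the universal property of
`Hᵠ = coker (C^{q-1} → Zᵠ)` (`HomologicalComplex.homologyIsCokernel`); well defined because
`a ⌣ δψ = ±δ(a ⌣ ψ)` (Hatcher 2002, §3.2, p. 206).
Relies on: `d_cochainCup` (Leibniz rule), via `cocyclesCup_toCocycles_right` (proved from it). [cite: Hatcher2002, §3.2  p. 206] -/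
def cupProductAux (h : p + q = n) (a : cocycles R R X p) :
    singularCohomology R R X q ⟶ singularCohomology R R X n :=
  Cofork.IsColimit.desc
    ((singularCochainComplex R R X).homologyIsCokernel ((ComplexShape.up ℕ).prev q) q rfl)
    (ModuleCat.ofHom (cocyclesCup h a) ≫ singularCohomology.π R R X n) (by
      rw [zero_comp]
      ext ψ
      change singularCohomology.π R R X n (cocyclesCup h a (toCocycles R R X _ q ψ)) = 0
      rw [cocyclesCup_toCocycles_right h rfl, map_smul, π_toCocycles, smul_zero])

/-- `cupProductAux h a [b] = [a ⌣ b]` (Hatcher 2002, §3.2, p. 206). [cite: Hatcher2002, §3.2  p. 206] -/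
@[simp]
lemma cupProductAux_π (h : p + q = n) (a : cocycles R R X p) (b : cocycles R R X q) :
    cupProductAux h a (singularCohomology.π R R X q b) =
      singularCohomology.π R R X n (cocyclesCup h a b) := by
  have e := Cofork.IsColimit.π_desc'
    ((singularCochainComplex R R X).homologyIsCokernel ((ComplexShape.up ℕ).prev q) q rfl)
    (ModuleCat.ofHom (cocyclesCup h a) ≫ singularCohomology.π R R X n)
  exact congr($(e (by
      rw [zero_comp]
      ext ψ
      change singularCohomology.π R R X n (cocyclesCup h a (toCocycles R R X _ q ψ)) = 0
      rw [cocyclesCup_toCocycles_right h rfl, map_smul, π_toCocycles, smul_zero])) b)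

/-- Second descent step, source side: `a ↦ ([b] ↦ [a ⌣ b])` as an `R`-linear map from cocycles
`Zᵖ` to `Hom_R(Hᵠ, Hⁿ)` (Hatcher 2002, §3.2, p. 206).
Relies on: `d_cochainCup` (Leibniz rule), via `cupProductAux`. [cite: Hatcher2002, §3.2  p. 206] -/
def cupProductCocycles (h : p + q = n) :
    cocycles R R X p →ₗ[R] (singularCohomology R R X q →ₗ[R] singularCohomology R R X n) where
  toFun a := (cupProductAux h a).hom
  map_add' a a' := by
    ext x
    induction x using singularCohomology_induction_on with
    | h b =>
      simp only [LinearMap.add_apply]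
      change cupProductAux h (a + a') _ = cupProductAux h a _ + cupProductAux h a' _
      simp only [cupProductAux_π, map_add, LinearMap.add_apply]
  map_smul' r a := by
    ext x
    induction x using singularCohomology_induction_on with
    | h b =>
      simp only [LinearMap.smul_apply, RingHom.id_apply]
      change cupProductAux h (r • a) _ = r • cupProductAux h a _
      simp only [cupProductAux_π, map_smul, LinearMap.smul_apply]

/-- `cupProductCocycles h a [b] = [a ⌣ b]` (Hatcher 2002, §3.2, p. 206). [cite: Hatcher2002, §3.2  p. 206] -/
@[simp]
lemma cupProductCocycles_apply_π (h : p + q = n) (a : cocycles R R X p) (b : cocycles R R X q) :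
    cupProductCocycles h a (singularCohomology.π R R X q b) =
      singularCohomology.π R R X n (cocyclesCup h a b) :=
  cupProductAux_π h a b

/-- `cupProductCocycles` kills coboundaries: `[δφ ⌣ b] = [δ(φ ⌣ b)] = 0`
(Hatcher 2002, §3.2, p. 206). Relies on: `d_cochainCup` (Leibniz rule), via
`cocyclesCup_toCocycles_left`. [cite: Hatcher2002, §3.2  p. 206] -/
lemma cupProductCocycles_toCocycles (h : p + q = n) (i : ℕ)
    (φ : (singularCochainComplex R R X).X i) :
    cupProductCocycles h (toCocycles R R X i p φ) = 0 := by
  ext x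
  induction x using singularCohomology_induction_on with
  | h b => rw [cupProductCocycles_apply_π, cocyclesCup_toCocycles_left h rfl, π_toCocycles,
      LinearMap.zero_apply]

/-- Second descent step: the morphism `Hᵖ(X; R) ⟶ Hom_R(Hᵠ(X; R), Hⁿ(X; R))`, `[a] ↦ ([b] ↦ [a ⌣ b])`,
from the universal property of `Hᵖ = coker (C^{p-1} → Zᵖ)` (Hatcher 2002, §3.2, p. 206).
Relies on: `d_cochainCup` (Leibniz rule), via `cupProductCocycles_toCocycles`. [cite: Hatcher2002, §3.2  p. 206] -/
def cupProductHom (h : p + q = n) :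
    singularCohomology R R X p ⟶
      ModuleCat.of R (singularCohomology R R X q →ₗ[R] singularCohomology R R X n) :=
  Cofork.IsColimit.desc
    ((singularCochainComplex R R X).homologyIsCokernel ((ComplexShape.up ℕ).prev p) p rfl)
    (ModuleCat.ofHom (cupProductCocycles h)) (by
      rw [zero_comp]
      ext φ : 2
      exact cupProductCocycles_toCocycles h _ φ)

/-- `cupProductHom h [a] = cupProductCocycles h a` (Hatcher 2002, §3.2, p. 206). [cite: Hatcher2002, §3.2  p. 206] -/
@[simp]
lemma cupProductHom_π (h : p + q = n) (a : cocycles R R X p) :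
    cupProductHom h (singularCohomology.π R R X p a) = cupProductCocycles h a := by
  have e := Cofork.IsColimit.π_desc'
    ((singularCochainComplex R R X).homologyIsCokernel ((ComplexShape.up ℕ).prev p) p rfl)
    (ModuleCat.ofHom (cupProductCocycles (X := X) h))
  exact congr($(e (by
      rw [zero_comp]
      ext φ : 2
      exact cupProductCocycles_toCocycles h _ φ)) a)

/-- The cup product `⌣ : Hᵖ(X; R) × Hᵠ(X; R) → Hⁿ(X; R)`, `p + q = n`, on singular cohomology with
coefficients in the commutative ring `R`, as an `R`-bilinear map (Hatcher 2002, §3.2, p. 206):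
`[a] ⌣ [b] = [a ⌣ b]` for cocycles `a`, `b` (`cupProduct_π_π`). Obtained by descending the
cocycle-level product `singularCochainComplex.cocyclesCup` through `Hⁿ = Zⁿ/Bⁿ` in each variable.
Relies on: `d_cochainCup` (Leibniz rule). [cite: Hatcher2002, §3.2  p. 206] -/
def cupProduct (h : p + q = n) :
    singularCohomology R R X p →ₗ[R] singularCohomology R R X q →ₗ[R] singularCohomology R R X n :=
  (cupProductHom h).hom

/-- The defining property of the cup product on classes: `[a] ⌣ [b] = [a ⌣ b]` for cocycles
`a ∈ Zᵖ`, `b ∈ Zᵠ` (Hatcher 2002, §3.2, p. 206). [cite: Hatcher2002, §3.2  p. 206] -/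
@[simp]
lemma cupProduct_π_π (h : p + q = n) (a : cocycles R R X p) (b : cocycles R R X q) :
    cupProduct h (singularCohomology.π R R X p a) (singularCohomology.π R R X q b) =
      singularCohomology.π R R X n (cocyclesCup h a b) := by
  change cupProductHom h (singularCohomology.π R R X p a) (singularCohomology.π R R X q b) = _
  rw [cupProductHom_π, cupProductCocycles_apply_π]

end CupProduct

/-! ### The unit and the ring axioms -/

/-- The unit cochain `1 ∈ C⁰(X; R)` is a cocycle: `δ1 (σ) = 1 - 1 = 0` (Hatcher 2002, §3.2,
p. 211). [cite: Hatcher2002, §3.2  p. 211] -/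
lemma d_cochainOne : (singularCochainComplex R R X).d 0 1 (cochainOne R X) = 0 := by
  refine singularCochainComplex.ext fun σ ↦ ?_
  rw [singularCochainComplex.d_apply]
  simp [Fin.sum_univ_two]
  rfl

variable (X) in
/-- The unit `1 = [1] ∈ H⁰(X; R)` of the cohomology ring, the class of the constant cochain `1`
(Hatcher 2002, §3.2, p. 211). [cite: Hatcher2002, §3.2  p. 211] -/
def singularCohomology.one : singularCohomology R R X 0 :=
  singularCohomology.π R R X 0 (singularCochainComplex.cocyclesMk (cochainOne R X) (d_cochainOne R))

variable {R} {p q n : ℕ}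

/-- `1 ⌣ b = b` in `H^q(X; R)` (Hatcher 2002, §3.2, p. 211). [cite: Hatcher2002, §3.2  p. 211] -/
theorem one_cupProduct (b : singularCohomology R R X q) :
    cupProduct (Nat.zero_add q) (singularCohomology.one R X) b = b := by
  induction b using singularCohomology_induction_on with
  | h b =>
    rw [singularCohomology.one, cupProduct_π_π]
    congr 1
    refine singularCochainComplex.cocycles_ext ?_
    rw [singularCochainComplex.iCocycles_cocyclesCup, singularCochainComplex.iCocycles_mk]
    exact one_cochainCup _

/-- `a ⌣ 1 = a` in `Hᵖ(X; R)` (Hatcher 2002, §3.2, p. 211). [cite: Hatcher2002, §3.2  p. 211] -/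
theorem cupProduct_one (a : singularCohomology R R X p) :
    cupProduct (Nat.add_zero p) a (singularCohomology.one R X) = a := by
  induction a using singularCohomology_induction_on with
  | h a =>
    rw [singularCohomology.one, cupProduct_π_π]
    congr 1
    refine singularCochainComplex.cocycles_ext ?_
    rw [singularCochainComplex.iCocycles_cocyclesCup, singularCochainComplex.iCocycles_mk]
    exact cochainCup_one _

/-- Associativity of the cup product on cohomology, `(a ⌣ b) ⌣ c = a ⌣ (b ⌣ c)`
(Hatcher 2002, §3.2, p. 211). [cite: Hatcher2002, §3.2  p. 211] -/
theorem cupProduct_assoc {r m k s : ℕ} (hpq : p + q = m) (hqr : q + r = k) (hm : m + r = s)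
    (hk : p + k = s) (a : singularCohomology R R X p) (b : singularCohomology R R X q)
    (c : singularCohomology R R X r) :
    cupProduct hm (cupProduct hpq a b) c = cupProduct hk a (cupProduct hqr b c) := by
  induction a using singularCohomology_induction_on with
  | h a =>
  induction b using singularCohomology_induction_on with
  | h b =>
  induction c using singularCohomology_induction_on with
  | h c =>
    simp only [cupProduct_π_π]
    congr 1
    refine singularCochainComplex.cocycles_ext ?_
    simp only [singularCochainComplex.iCocycles_cocyclesCup]
    exact cochainCup_assoc hpq hqr hm hk _ _ _

variable (R X) in
/-- Graded commutativity of the cup product: `a ⌣ b = (-1)^{pq} b ⌣ a` for `a ∈ Hᵖ(X; R)`,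
`b ∈ Hᵠ(X; R)`, `R` commutative (Hatcher 2002, Thm. 3.11). Named fact (unproved here) with `R`,
`X` explicit and all degrees quantified inside, so that one witness
`(h : cupProduct_gradedComm R X)` serves every degree triple; downstream users
(`SingularHomology/PoincareDuality.lean`, `Motives/BettiRealization.lean`) take it as such a
hypothesis. [cite: Hatcher2002, Thm. 3.11] -/
def cupProduct_gradedComm : Prop :=
  ∀ {p q n : ℕ} (h : p + q = n) (h' : q + p = n) (a : singularCohomology R R X p)
    (b : singularCohomology R R X q),
    cupProduct h a b = ((-1 : R) ^ (p * q)) • cupProduct h' b a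

/-- Naturality of the cup product: `f^*(a ⌣ b) = f^*a ⌣ f^*b`, i.e. the induced map
`f^* : H^*(Y; R) → H^*(X; R)` is multiplicative (Hatcher 2002, Prop. 3.10). [cite: Hatcher2002, Prop. 3.10] -/
theorem cupProduct_map (f : C(X, Y)) (h : p + q = n) (a : singularCohomology R R Y p)
    (b : singularCohomology R R Y q) :
    singularCohomology.map R R f n (cupProduct h a b) =
      cupProduct h (singularCohomology.map R R f p a) (singularCohomology.map R R f q b) := by
  induction a using singularCohomology_induction_on with
  | h a =>
  induction b using singularCohomology_induction_on with
  | h b =>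
    simp only [cupProduct_π_π, singularCohomology.map_π]
    congr 1
    refine singularCochainComplex.cocycles_ext ?_
    simp only [singularCochainComplex.iCocycles_cocyclesCup, singularCochainComplex.iCocycles_cocyclesMap]
    exact cochainCup_map f h _ _

/-- The induced map preserves the unit: `f^* 1 = 1` (Hatcher 2002, Prop. 3.10 and p. 211). [cite: Hatcher2002, Prop. 3.10 and p. 211] -/
theorem singularCohomology.map_one (f : C(X, Y)) :
    singularCohomology.map R R f 0 (singularCohomology.one R Y) = singularCohomology.one R X := by
  rw [singularCohomology.one, singularCohomology.one, singularCohomology.map_π]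
  congr 1
  exact singularCochainComplex.cocycles_ext (by
    rw [singularCochainComplex.iCocycles_cocyclesMap, singularCochainComplex.iCocycles_mk,
      singularCochainComplex.iCocycles_mk]
    rfl)

end Literature.AlgebraicTopology.SingularHomology
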